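import Summits.BirchSwinnertonDyer.BirchSwinnertonDyer.Theorems.ByReductionTypeAtTwoSupersingularIwasawaAlgebraBiduality
import HarnessLib

/-!
# Route `ByReductionTypeAtTwo` (rung K4), crux `SupersingularRankZeroAtTwo` (item stmt-BirchSwinnertonDyer-19097), stub 5
# `stub_flatKernelCyclic` (hand h13), sub-hand h13b, brick (K4-algebra): **`Hom(Λ^∨, ℚ/ℤ)` is cyclic for the shift by ANY
# associate `u` of `T`** — Pontryagin biduality of `Λ = ℤ_p⟦T⟧` re-keyed: if `T ∣ u` and `u ∣ T` then the `Λ`-module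
# `Hom(Λ^∨, ℚ/ℤ)` with `T` acting as `y ↦ y ∘ ψ_u`, `ψ_u χ = χ ∘ (u ·)` (tree structure `IwasawaDual.IsLocNil.module`) is generated
# by «evaluate at `1`» (pure algebra; cell `bsd-2adic`, seat `bsd-2adic-t42` GEN 45; `--supports 19097`, helper; sequel of
# `…IwasawaAlgebraBiduality`)

HONEST FRAMING (D-0036/D-0054): THEOREMS ONLY (no definition, no named fact, no `sorry`, no instance).  WHY (the KEYING of
h13b, memo `t42/gen44/FLAT-KERNEL-CYCLIC-GEN44.md` §2 (iii)): the Kummer injection `j : Sel_∞ ⧸ Sel♭ ↪ Λ^∨` intertwines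
`conj_γ − 1` NOT with the shift by `T` but with the shift by `u = (1+T)⁻¹ − 1` — the tree's conventions are
`(T • z)(y) = z(g⁻¹y)` (`Sprung2012.lambdaSMul_X_apply`) and `(conj_σ φ)(h) = σ φ(σ⁻¹hσ)` (`conjH1`), so the Kummer point of
`conj_{res g} s` is `g • Q` and `(f • z)(g • x) = (((1+T)⁻¹ f) • z)(x)`; and `γ ∈ (res g) · ker κ` EXACTLY because
`ZpExtension.IsTopGenerator` pins `κ γ = κ (res g) = 1`.  The element `u = −T(1+T)⁻¹` is an associate of `T`; this file proves
the cyclicity needed by `LambdaDual.exists_cyclic_characterModule_of_injective` for every such `u`, by a triangular recursion on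
`u`-adic digits (no power-series substitution).  Nothing about any curve; 19097 OPEN; BSD proved for no curve.

* §1 `exists_dualLambda_shift_mul` (the shift `ψ_u : χ ↦ χ ∘ (u·)` of `Λ^∨` exists for every `u`), `coe_shift_mul_pow_apply`
  (`ψ_u^i χ = χ ∘ (u^i ·)`), `isLocNil_dualLambda_mul` (`(p, ψ_u)` locally nilpotent as soon as `T ∣ u`).
* §2 `exists_digits_of_dvd_X` — for `u ∣ T`, every `f ∈ Λ` has `u`-ADIC DIGITS `c_i ∈ ℤ_p`:
  `f = ∑_{i<M} C(c_i) u^i + u^M r_M` for every `M` (recursion `r_{M+1} = w · shift(r_M)`, `T = u w`).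
* §3 **`exists_cyclic_characterModule_dualLambda_mul`** — for `T ∣ u ∣ T`: `Hom(Λ^∨, ℚ/ℤ) = Λ ∙ ev₁` for the `ψ_u`-structure
  (biduality `exists_eq_eval_of_character_dualLambda`: `y = ev_f`; then `(∑ c_i T^i) • ev₁ = ev_f` since a character killed by
  `ψ_u^N` kills `u^N Λ`).

References: [NeukirchSchmidtWingberg2008] I §1 (1.1.8); [Lang1990] Ch. 5 §1; [GreenbergLNM1716] §1 p. 60; [KitajimaOtsuki2018] Prop. 3.32;
tree p824877 `…IwasawaAlgebraBiduality`.
-/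

set_option autoImplicit false
-- the Theorems namespace of this sub repeats the summit name by design (D-0017 nested layout)
set_option linter.dupNamespace false

noncomputable section

open scoped Classical
open Finset PowerSeries

namespace Summit.BirchSwinnertonDyer.BirchSwinnertonDyer.Theorems

namespace OddBlindNF

namespace LambdaDual

open Literature.NumberTheory.EllipticCurves Literature.NumberTheory.EllipticCurves.IwasawaDual

variable {p : ℕ} [hp : Fact p.Prime]
variable {Q : AddSubgroup (PowerSeries ℤ_[p] →+ AddCircle (1 : ℚ))}

/-! ### §1 The shift of `Λ^∨` by an arbitrary `u ∈ Λ` -/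

/-- **The shift `ψ_u : χ ↦ χ ∘ (u ·)` of the discrete dual exists** for every `u ∈ Λ` (the membership criterion «kills `T^n Λ` and
`p^k Λ`» is preserved, `Λ` being commutative). [cite: Lang1990, Ch. 5 §1] -/
theorem exists_dualLambda_shift_mul
    (hQ : ∀ χ, χ ∈ Q ↔ ∃ n k : ℕ, (∀ f, χ (X ^ n * f) = 0) ∧ (∀ f, χ ((p : PowerSeries ℤ_[p]) ^ k * f) = 0))
    (u : PowerSeries ℤ_[p]) :
    ∃ ψ : AddMonoid.End Q, ∀ χ : Q,
      ((ψ χ : Q) : PowerSeries ℤ_[p] →+ AddCircle (1 : ℚ)) =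
        (χ : PowerSeries ℤ_[p] →+ AddCircle (1 : ℚ)).comp (AddMonoidHom.mulLeft u) := by
  have hmem : ∀ χ : Q, (χ : PowerSeries ℤ_[p] →+ AddCircle (1 : ℚ)).comp (AddMonoidHom.mulLeft u) ∈ Q := by
    intro χ
    obtain ⟨n, k, hn, hk⟩ := (hQ χ).mp χ.2
    refine (hQ _).mpr ⟨n, k, fun f ↦ ?_, fun f ↦ ?_⟩
    · rw [AddMonoidHom.comp_apply, AddMonoidHom.coe_mulLeft, ← mul_assoc, mul_comm u, mul_assoc, hn]
    · rw [AddMonoidHom.comp_apply, AddMonoidHom.coe_mulLeft, ← mul_assoc, mul_comm u, mul_assoc, hk]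
  refine ⟨{ toFun := fun χ ↦ ⟨_, hmem χ⟩, map_zero' := Subtype.ext (by ext f; rfl),
            map_add' := fun χ χ' ↦ Subtype.ext (by ext f; rfl) }, fun χ ↦ rfl⟩

/-- The iterated shift: `ψ_u^i χ = χ ∘ (u^i ·)`. [folklore] -/
theorem coe_shift_mul_pow_apply {u : PowerSeries ℤ_[p]} {ψ : AddMonoid.End Q}
    (hψ : ∀ χ : Q, ((ψ χ : Q) : PowerSeries ℤ_[p] →+ AddCircle (1 : ℚ)) =
      (χ : PowerSeries ℤ_[p] →+ AddCircle (1 : ℚ)).comp (AddMonoidHom.mulLeft u))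
    (i : ℕ) (χ : Q) (f : PowerSeries ℤ_[p]) :
    (((ψ ^ i) χ : Q) : PowerSeries ℤ_[p] →+ AddCircle (1 : ℚ)) f = (χ : PowerSeries ℤ_[p] →+ AddCircle (1 : ℚ)) (u ^ i * f) := by
  induction i generalizing f with
  | zero => rw [pow_zero, pow_zero, one_mul]; rfl
  | succ i ih =>
    rw [pow_succ', AddMonoid.End.coe_mul, Function.comp_apply, hψ, AddMonoidHom.comp_apply, AddMonoidHom.coe_mulLeft, ih,
      ← mul_assoc, ← pow_succ]

/-- **`(p, ψ_u)` is locally nilpotent on `Λ^∨` as soon as `T ∣ u`**: a character killing `(T^n, p^k)` is killed by `p^k` and by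
`ψ_u^n` (`u^n ∈ T^n Λ`). [cite: GreenbergLNM1716, §1 p. 60 (after Conj. 1.3)] -/
theorem isLocNil_dualLambda_mul
    (hQ : ∀ χ, χ ∈ Q ↔ ∃ n k : ℕ, (∀ f, χ (X ^ n * f) = 0) ∧ (∀ f, χ ((p : PowerSeries ℤ_[p]) ^ k * f) = 0))
    {u : PowerSeries ℤ_[p]} (hXu : X ∣ u) {ψ : AddMonoid.End Q}
    (hψ : ∀ χ : Q, ((ψ χ : Q) : PowerSeries ℤ_[p] →+ AddCircle (1 : ℚ)) =
      (χ : PowerSeries ℤ_[p] →+ AddCircle (1 : ℚ)).comp (AddMonoidHom.mulLeft u)) :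
    IsLocNil p ψ := by
  refine ⟨fun χ ↦ ?_, fun χ ↦ ?_⟩
  · obtain ⟨n, k, -, hk⟩ := (hQ χ).mp χ.2
    refine ⟨k, Subtype.ext ?_⟩
    ext f
    rw [AddSubgroupClass.coe_nsmul, AddMonoidHom.nsmul_apply, ← map_nsmul, nsmul_eq_mul, Nat.cast_pow, hk]
    rfl
  · obtain ⟨n, k, hn, -⟩ := (hQ χ).mp χ.2
    obtain ⟨v, rfl⟩ := hXu
    refine ⟨n, Subtype.ext ?_⟩
    ext f
    rw [coe_shift_mul_pow_apply hψ, mul_pow, mul_assoc, hn]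
    rfl

/-! ### §2 `u`-adic digits for an associate-divisor `u ∣ T` -/

/-- **`u`-adic digits.**  If `u ∣ T` in `Λ = ℤ_p⟦T⟧` then every `f ∈ Λ` admits `c : ℕ → ℤ_p` with
`f = ∑_{i<M} C(c_i) u^i + u^M · r_M` for EVERY `M` (triangular recursion: `r_0 = f`, `c_M = r_M(0)`,
`r_M − C(c_M) = T · shift(r_M) = u · (w · shift(r_M))` where `T = u w`). [cite: Lang1990, Ch. 5 §1] -/
theorem exists_digits_of_dvd_X {u : PowerSeries ℤ_[p]} (huX : u ∣ X) (f : PowerSeries ℤ_[p]) :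
    ∃ c : ℕ → ℤ_[p], ∀ M : ℕ, ∃ r : PowerSeries ℤ_[p],
      f = ∑ i ∈ range M, C (c i) * u ^ i + u ^ M * r := by
  obtain ⟨w, hw⟩ := huX
  -- the remainders `r M`
  obtain ⟨r, hr0, hrS⟩ : ∃ r : ℕ → PowerSeries ℤ_[p], r 0 = f ∧
      ∀ M, r (M + 1) = w * PowerSeries.mk fun q ↦ coeff (q + 1) (r M) :=
    ⟨fun M ↦ Nat.rec f (fun _ rM ↦ w * PowerSeries.mk fun q ↦ coeff (q + 1) rM) M, rfl, fun _ ↦ rfl⟩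
  refine ⟨fun M ↦ constantCoeff (r M), fun M ↦ ⟨r M, ?_⟩⟩
  induction M with
  | zero => rw [Finset.sum_range_zero, pow_zero, zero_add, one_mul, hr0]
  | succ M ih =>
    have hdec : r M = X * (PowerSeries.mk fun q ↦ coeff (q + 1) (r M)) + C (constantCoeff (r M)) :=
      eq_X_mul_shift_add_const (r M)
    rw [Finset.sum_range_succ, pow_succ, hrS M]
    linear_combination ih + u ^ M * hdec + u ^ M * (PowerSeries.mk fun q ↦ coeff (q + 1) (r M)) * hw

/-! ### §3 `Hom(Λ^∨, ℚ/ℤ)` is cyclic for the shift by an associate of `T` -/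

/-- **`Hom(Λ^∨, ℚ/ℤ)` is a CYCLIC `Λ`-module for the `ψ_u`-structure, `T ∣ u ∣ T`, generated by `ev₁ : χ ↦ χ(1)`.**
Every additive `y : Λ^∨ → ℚ/ℤ` is `ev_f` (biduality, `exists_eq_eval_of_character_dualLambda`); with the `u`-adic digits
`c` of `f` (§2) and `F := ∑ c_i T^i`, the truncated action gives `(F • ev₁)(χ) = ∑_{i<N} (c_i mod p^k) χ(u^i) = χ(∑_{i<N} C(c_i)u^i)
= χ(f) − χ(u^N r_N) = χ(f)` for `χ` killed by `ψ_u^N` and `p^k`.  Used with `u = (1+T)⁻¹ − 1` (the shift matching `conj_γ − 1`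
under the Kummer injection). [cite: NeukirchSchmidtWingberg2008, I §1 (1.1.8)] [cite: KitajimaOtsuki2018, Prop. 3.32 (arXiv:1607.03612 p. 16)] -/
theorem exists_cyclic_characterModule_dualLambda_mul
    (hQ : ∀ χ, χ ∈ Q ↔ ∃ n k : ℕ, (∀ f, χ (X ^ n * f) = 0) ∧ (∀ f, χ ((p : PowerSeries ℤ_[p]) ^ k * f) = 0))
    {u : PowerSeries ℤ_[p]} (hXu : X ∣ u) (huX : u ∣ X) {ψ : AddMonoid.End Q}
    (hψ : ∀ χ : Q, ((ψ χ : Q) : PowerSeries ℤ_[p] →+ AddCircle (1 : ℚ)) =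
      (χ : PowerSeries ℤ_[p] →+ AddCircle (1 : ℚ)).comp (AddMonoidHom.mulLeft u)) :
    letI := (isLocNil_dualLambda_mul hQ hXu hψ).module (A := AddCircle (1 : ℚ))
    ∃ y₀ : Q →+ AddCircle (1 : ℚ), ∀ y : Q →+ AddCircle (1 : ℚ), ∃ F : PowerSeries ℤ_[p], F • y₀ = y := by
  letI := (isLocNil_dualLambda_mul hQ hXu hψ).module (A := AddCircle (1 : ℚ))
  refine ⟨(AddMonoidHom.eval (1 : PowerSeries ℤ_[p])).comp Q.subtype, fun y ↦ ?_⟩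
  obtain ⟨f, hf⟩ := exists_eq_eval_of_character_dualLambda hQ y
  obtain ⟨c, hc⟩ := exists_digits_of_dvd_X huX f
  refine ⟨PowerSeries.mk c, ?_⟩
  ext χ
  rw [hf χ]
  obtain ⟨N, hN⟩ := (isLocNil_dualLambda_mul hQ hXu hψ).nil χ
  obtain ⟨n, k, -, hk⟩ := (hQ χ).mp χ.2
  have hpk : p ^ k • χ = 0 := Subtype.ext (by
    ext g; rw [AddSubgroupClass.coe_nsmul, AddMonoidHom.nsmul_apply, nsmul_apply_eq_zero _ hk]; rfl)
  show (isLocNil_dualLambda_mul hQ hXu hψ).smulFun (PowerSeries.mk c) _ χ = _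
  rw [(isLocNil_dualLambda_mul hQ hXu hψ).smulFun_apply (PowerSeries.mk c) _ hN hpk, evalT_def]
  have hterm : ∀ i ∈ range N, zpT p k (coeff i (PowerSeries.mk c))
      (((AddMonoidHom.eval (1 : PowerSeries ℤ_[p])).comp Q.subtype) ((ψ ^ i) χ)) =
      (χ : PowerSeries ℤ_[p] →+ AddCircle (1 : ℚ)) (C (c i) * u ^ i) := by
    intro i _
    rw [zpT_def, coeff_mk]
    show (PadicInt.toZModPow k (c i)).val • ((((ψ ^ i) χ : Q) : PowerSeries ℤ_[p] →+ AddCircle (1 : ℚ)) 1) = _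
    rw [coe_shift_mul_pow_apply hψ, mul_one, apply_C_mul_eq_val_nsmul _ hk]
  rw [Finset.sum_congr rfl hterm, ← map_sum]
  obtain ⟨r, hr⟩ := hc N
  have hkill : (χ : PowerSeries ℤ_[p] →+ AddCircle (1 : ℚ)) (u ^ N * r) = 0 := by
    rw [← coe_shift_mul_pow_apply hψ N χ r, hN]
    rfl
  conv_rhs => rw [hr, map_add, hkill, add_zero]

end LambdaDual

end OddBlindNF

end Summit.BirchSwinnertonDyer.BirchSwinnertonDyer.Theorems

end
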